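import Summits.CriticalPhenomena.SAWScalingLimit.Theses.SAWQuarterTwist

/-!
# Line `birth` — registered skeleton for the crux `TwistedPropagatorLaw` (stmt-CriticalPhenomena-16650)

Crux (FIXED; rank 2 of `route-CriticalPhenomena-SAWQuarterTwist`, sub-problem `SAWScalingLimit`): the
WHOLE-PLANE QUARTER-TWISTED PROPAGATOR LAW. For hexagonal domains `Λ_s` exhausting the plane at scale
`s → ∞` around the source hexagon of the cell `x_s` (source mid-edge `a_s` = the left vertical side of
that hexagon, cut = the horizontal ray from `triEmbed x_s` to the right), the critical SAW parafermion
`F^tw_s(e) = Σ_{γ ⊂ Λ_s : a_s → e} x_c^{ℓ(γ)} e^{-i(5/8)W(γ)} i^{N(γ)}` twisted by the algebraic crossing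
number `N` of the cut satisfies, for ONE exponent `α > 0` and ONE amplitude `C ≠ 0`,

  `s^{α-2} Σ_e ψ((m_e − triEmbed x_s)/s) F^tw_s(e) ⟶ C ∫ ψ(w) |w|^{-α} e^{-iαθ(w)} dw`   (`s → ∞`)

for every bulk test function `ψ ∈ C_c(ℂ ∖ 0)`, `θ(w) = arg(−w) + π ∈ (0, 2π]` the angle measured from the
cut; i.e. the smeared, power-normalised twisted two-point function converges to the pure power `C·w^{-α}`
(branch cut on the lattice cut ray).

## The cut — existence / regularity / rigidity of the whole-plane scaling limit

Write `T_s(ψ) = T[Λ, x, α](ψ, s)` for the left-hand side (`smeared` below), `𝒜` for the admissible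
exhaustions `(Λ, x)` (every `Λ_s` simply connected; every compact `K ⊂ ℂ` is covered by
`(hexCenter(Λ_s) − triEmbed x_s)/s` eventually) and `𝒯 = C_c(ℂ ∖ 0)` for the test functions (exactly the
crux's hypotheses, `IsPlaneExhaustion`, `TestFn`). The crux is `∃ α > 0, ∃ C ≠ 0, ∀ (Λ,x) ∈ 𝒜, ∀ ψ ∈ 𝒯,
T_s(ψ) → C·∫ψ w^{-α}`. The line factors it through the LIMIT FUNCTIONAL `Φ : 𝒯 → ℂ`:

* S1 `stub_scalingLimit` (HARDEST, open — existence with a power normalisation): `∃ α > 0` and a functional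
  `Φ`, NONDEGENERATE (`Φ ψ₀ ≠ 0` for some `ψ₀ ∈ 𝒯`), with `T[Λ,x,α](ψ,s) → Φ ψ` for ALL `(Λ,x) ∈ 𝒜`, `ψ ∈ 𝒯`
  (`IsScalingLimit α Φ`). This is where the crux's recorded why-might-fail lives and ONLY here: at `c = 0`
  the chiral pair `⟨ψ†ψ⟩` might carry `(log s)^k` corrections or two competing flux sectors, and then NO
  power `s^{α-2}` normalises the smeared observable to a nondegenerate limit. It asserts nothing about the
  shape of `Φ`.
* S2 `stub_holomorphicDensity` (open — the regularity half): if a universal limit functional exists at an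
  exponent `α > 0`, then one is given by a DENSITY `f ∈ L¹_loc(ℂ ∖ 0)` which is HOLOMORPHIC OFF THE CUT
  (`DifferentiableOn ℂ f slitRegion`, `slitRegion = ℂ ∖ [0, ∞) = {w | −w ∈ Complex.slitPlane}`):
  `IsScalingLimit α (ψ ↦ ∫ ψ f)` — by uniqueness of limits `Φ = ∫ · f` on `𝒯` (this phrasing through
  `IsScalingLimit` itself makes S2 immune to vacuity: were there no admissible exhaustion, `f = 0` would do).
  What is automatic and what is not: given the convergence in `IsScalingLimit`, the
  local masses `s^{α-2} Σ_{z_e ∈ K} |F^tw_s(e)|` are bounded (Banach–Steinhaus on `C(K)`), so `Φ` is a Radon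
  measure on `ℂ ∖ 0`; summing the EXACT quarter-twist vertex relation (the route's support item
  `QuarterTwistRelation`: DCS Lemma 1 transported by the `i^N` gauge, valid at every vertex off the cut)
  against `χ(c_v/s)` gives edge by edge `Σ_e F(e)·d_e·(χ(c_v/s) − χ(c_{v'}/s)) = 0`, `d_e = c_{v'} − c_v`,
  i.e. in the limit `Φ(∂̄χ) + Φ₂(∂χ) = 0`, where `Φ₂` is the limit of the ORIENTATION-WEIGHTED sums
  `s^{α-2} Σ_e 3d_e² ∂χ(z_e) F(e)` (`3d_e² = e^{2iφ_e} ∈ {−1, e^{±iπ/3}}` for the three edge classes). So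
  holomorphy off the cut (`Φ(∂̄χ) = 0`, then Weyl's lemma) is EQUIVALENT to `Φ₂ ∘ ∂ = 0` — the three
  mid-edge orientation classes must carry balanced amplitudes in the limit (`Σ_k A_k e^{2iφ_k} = 0`); the
  vertex relation alone does not give it (`Literature.Barriers.CriticalPhenomena.ParafermionicHalfCauchyRiemann`).
  This, and the absence of singular mass of `Φ` on the gauge cut (expected from gauge covariance: moving the
  cut multiplies `F^tw` by locally constant phases, `|F^tw|` is gauge invariant), is the open content of S2.
* S3 `stub_profileRigidity` (size M–L, classical complex analysis, LANDABLE NOW): a density `f`, holomorphic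
  on `slitRegion` and locally integrable on `ℂ ∖ 0`, whose functional `ψ ↦ ∫ ψ f` is DILATION COVARIANT of
  degree `α − 2` (`∫ ψ(c·) f = c^{α-2} ∫ ψ f`, `c > 0`) is a pure power on test functions:
  `∃ C, ∀ ψ ∈ 𝒯, ∫ ψ f = C ∫ ψ(w)|w|^{-α}e^{-iαθ(w)} dw`. Proof: the fundamental lemma of the calculus of
  variations gives `f(w/c) = c^{α} f(w)` a.e., hence everywhere on the (open) slit region by continuity;
  `g(w) = f(w)·exp(α(log(−w) + iπ))` is holomorphic and dilation invariant there, so `w g'(w) = 0`, `g ≡ C`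
  on the connected (star-shaped about `−1`) slit region; the cut is Lebesgue-null.

`TwistedPropagatorLaw_of` (kernel-checked, no `sorry` of its own) supplies the three pieces of genuine glue:
(a) UNIVERSALITY ⇒ DILATION COVARIANCE (`dilationCovariant_of_isScalingLimit`): re-indexing an admissible
exhaustion `s ↦ cs` is again admissible and `T[Λ,x,α](ψ(c·), cs) = c^{α-2}·T[Λ(c·),x(c·),α](ψ, s)` exactly
(`smeared_rescale`), so uniqueness of limits along `atTop` gives `Φ(ψ(c·)) = c^{α-2} Φ(ψ)` for any universal
limit `Φ` — applied to S2's `∫ · f`, which feeds S3; (b) UNIQUENESS OF LIMITS along one admissible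
exhaustion identifies S1's `Φ` with S2's `∫ · f` on `𝒯`; (c) `C ≠ 0` from the nondegeneracy in S1; then S3's
constant rewrites the limit as `C ∫ ψ w^{-α}`. (If no admissible exhaustion existed the crux would be
vacuous; the proof splits on this, so it needs no lattice construction.) It concludes the route decl BY
NAME through
`twistedPropagatorLaw_iff : TwistedPropagatorLaw' ↔ TwistedPropagatorLaw := Iff.rfl` (the primed form is the
crux with its three `let`s delta/zeta-reduced into the §1 vocabulary; the file re-opens the route file's
scopes so that the `if`-instances and coercions coincide).

Disproof / negatives used: no `Cruxes/TwistedPropagatorLaw/Disproof.lean` exists (`ledger crux ls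
stmt-CriticalPhenomena-16650`: no workfiles, 2026-08-17), so there is no `_false_without_` obstruction to
honour and no landed `Theorems/TwistedPropagatorLaw/Negative/*`; `ledger negatives --problem
CriticalPhenomena` (11 entries) has nothing on whole-plane / twisted / interior-source observables (the SAW
entries are stmt-0772 all-`δ` tightness, stmt-5420 boundary-rooted `HexObservableLimit`, stmt-8261, stmt-8312
— none is used or restated: every statement here is a whole-plane, bulk-sourced, `s → ∞` statement).
Vacuity pass: `IsScalingLimit α Φ` only constrains `Φ` on `𝒯` and only through limits along admissible
exhaustions, which exist (refuter R2-review: `Λ_s` = lattice disc of radius `s²`, `x_s = 0`), so `Φ` is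
pinned on `𝒯` by uniqueness of limits; S2 is stated through `IsScalingLimit` on both sides (no hidden "every
functional has a density" reading even in a vacuous world); at exponents below the true one the limit is `0`
and S2/S3 hold with `f = 0`, `C = 0` — the amplitude `C ≠ 0` of the crux comes from S1's nondegeneracy
clause alone; S3 is a theorem of classical analysis (true for every real `α`); no stub fixes a threshold or
a specific `α` (`∃ α` absorbs the flux sign, `α mod 1 ∈ {1/4, 3/4}` expected, `α = 5/4` predicted).
-/

noncomputable section

-- the route file's scopes, re-opened verbatim so that elaboration (instances of the `if`s, coercions)
-- coincides with the crux's and `twistedPropagatorLaw_iff` below is `Iff.rfl`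
open scoped BigOperators Topology Manifold Classical MeasureTheory ProbabilityTheory Matrix InnerProductSpace ComplexConjugate ContinuousMap
open Filter Set Function TopologicalSpace MeasureTheory
open Literature.Probability.RandomPlanarGeometry Literature.Probability.LatticeModels

namespace Summit.CriticalPhenomena.SAWScalingLimit.Cruxes.TwistedPropagatorLaw.Birth

-- BEGIN VOCABULARY
/-! ### 1. Vocabulary — the crux's `let`s as definitions -/

/-- The crossing sign of the directed lattice step `p → q` relative to the cut of the cell `x₀`: `+1` for
an upward traversal of a vertical edge crossed by the horizontal ray from `triEmbed x₀` to the right, `−1`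
for a downward one, `0` otherwise. VERBATIM the crux's `let sgn` (at one scale, `x₀ = x s`). -/
def cutSign (x₀ : Site 2) (p q : HexVertex) : ℤ :=
  if q.2 = 0 ∧ p.2 = 1 ∧ p.1 = q.1 - Pi.single 1 1 ∧ q.1 1 = x₀ 1 ∧ x₀ 0 ≤ q.1 0 then 1
  else if p.2 = 0 ∧ q.2 = 1 ∧ q.1 = p.1 - Pi.single 1 1 ∧ p.1 1 = x₀ 1 ∧ x₀ 0 ≤ p.1 0 then -1 else 0

/-- The source mid-edge: the left vertical side of the hexagon of the cell `x₀`. VERBATIM the crux's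
`let a`. -/
def srcEdge (x₀ : Site 2) : Sym2 HexVertex :=
  s((x₀ - Pi.single 0 1, (0 : Fin 2)), (x₀ - Pi.single 0 1 - Pi.single 1 1, (1 : Fin 2)))

/-- The twist exponent `N(γ)`: the algebraic number of traversals of cut edges by the walk `γ` (sum of the
crossing signs of its consecutive vertex pairs). VERBATIM the exponent in the crux's `let F`. -/
def twistExp (x₀ : Site 2) {Λ : Finset HexVertex} {a z : Sym2 HexVertex}
    (γ : SAW.HexMidEdgeSAW Λ a z) : ℤ :=
  ((γ.verts.zip γ.verts.tail).map (fun pq => cutSign x₀ pq.1 pq.2)).sum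

/-- **The quarter-twisted observable** `F^tw_{Λ,x₀}(z) = Σ_{γ ⊂ Λ : a → z} x_c^{ℓ(γ)} e^{-i(5/8)W(γ)} i^{N(γ)}`
with source `a = srcEdge x₀`. VERBATIM the crux's `let F` (at one scale). -/
def twObs (Λ : Finset HexVertex) (x₀ : Site 2) (z : Sym2 HexVertex) : ℂ :=
  ∑ γ : SAW.HexMidEdgeSAW Λ (srcEdge x₀) z,
    γ.weight SAW.hexCriticalFugacity (5 / 8) * Complex.I ^ twistExp x₀ γ

/-- Admissible whole-plane exhaustions `(Λ, x)`: every `Λ_s` is simply connected, and every compact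
`K ⊂ ℂ` is covered by the rescaled recentred domain `(hexCenter(Λ_s) − triEmbed x_s)/s` for all large `s`.
VERBATIM the crux's two hypotheses on `(Λ, x)`. -/
def IsPlaneExhaustion (Λ : ℝ → Finset HexVertex) (x : ℝ → Site 2) : Prop :=
  (∀ s, SAW.hexDomainSimplyConnected (Λ s)) ∧
    ∀ K : Set ℂ, IsCompact K → ∀ᶠ s : ℝ in Filter.atTop, ∀ v : HexVertex,
      (hexCenter v - triEmbed (x s)) / (s : ℂ) ∈ K → v ∈ Λ s

/-- Bulk test functions `ψ ∈ C_c(ℂ ∖ 0)`. VERBATIM the crux's three hypotheses on `ψ`. -/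
def TestFn (ψ : ℂ → ℂ) : Prop :=
  Continuous ψ ∧ HasCompactSupport ψ ∧ tsupport ψ ⊆ {(0 : ℂ)}ᶜ

/-- The smeared, power-normalised, rescaled twisted observable
`T[Λ,x,α](ψ, s) = s^{α-2} Σ_{e ∈ Ω(Λ_s)} ψ((m_e − triEmbed x_s)/s) F^tw_s(e)`. VERBATIM the function whose
limit the crux takes. -/
def smeared (Λ : ℝ → Finset HexVertex) (x : ℝ → Site 2) (α : ℝ) (ψ : ℂ → ℂ) (s : ℝ) : ℂ :=
  (s : ℂ) ^ ((α : ℂ) - 2) *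
    ∑ᶠ e ∈ SAW.hexDomainMidEdges (Λ s),
      ψ ((SAW.hexMidpoint e - triEmbed (x s)) / (s : ℂ)) * twObs (Λ s) (x s) e

/-- The pure-power profile paired with `ψ`: `∫ ψ(w) |w|^{-α} e^{-iαθ(w)} dw`, `θ(w) = arg(−w) + π ∈ (0, 2π]`
the angle from the cut (so the integrand is `ψ(w)·w^{-α}` with the branch cut on `[0, ∞)`). VERBATIM the
crux's limit value without the amplitude `C`. -/
def profileIntegral (α : ℝ) (ψ : ℂ → ℂ) : ℂ :=
  ∫ w, ψ w * ((‖w‖ ^ (-α) : ℝ) : ℂ) *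
    Complex.exp (-(Complex.I * (α : ℂ) * ((Complex.arg (-w) + Real.pi : ℝ) : ℂ)))

/-- `Φ` is a (universal) WHOLE-PLANE SCALING LIMIT of the twisted observable at exponent `α`: along every
admissible exhaustion and for every test function, `T[Λ,x,α](ψ, s) → Φ ψ` as `s → ∞`. -/
def IsScalingLimit (α : ℝ) (Φ : (ℂ → ℂ) → ℂ) : Prop :=
  ∀ (Λ : ℝ → Finset HexVertex) (x : ℝ → Site 2) (ψ : ℂ → ℂ), IsPlaneExhaustion Λ x → TestFn ψ →
    Filter.Tendsto (smeared Λ x α ψ) Filter.atTop (nhds (Φ ψ))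

/-- Dilation covariance of degree `α − 2` of a functional on test functions:
`Φ(ψ(c·)) = c^{α-2} Φ(ψ)` for `c > 0` (the covariance of `ψ ↦ ∫ ψ(w) w^{-α} dw`). -/
def DilationCovariant (α : ℝ) (Φ : (ℂ → ℂ) → ℂ) : Prop :=
  ∀ c : ℝ, 0 < c → ∀ ψ : ℂ → ℂ, TestFn ψ →
    Φ (fun w => ψ ((c : ℂ) * w)) = (c : ℂ) ^ ((α : ℂ) - 2) * Φ ψ

/-- The slit region `ℂ ∖ [0, ∞)`: the plane cut along the (rescaled) lattice cut ray, where
`θ = arg(−·) + π` is continuous. -/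
def slitRegion : Set ℂ := {w | -w ∈ Complex.slitPlane}

/-! ### 2. The three statements of the line, named -/

/-- **S1, named — a nondegenerate whole-plane scaling limit exists under a power normalisation.** -/
def ScalingLimitExists : Prop :=
  ∃ α : ℝ, 0 < α ∧ ∃ Φ : (ℂ → ℂ) → ℂ, (∃ ψ₀ : ℂ → ℂ, TestFn ψ₀ ∧ Φ ψ₀ ≠ 0) ∧ IsScalingLimit α Φ

/-- **S2, named — the scaling limit has a locally integrable density, holomorphic off the cut**: whenever
a whole-plane scaling limit exists at an exponent `α > 0`, some `f ∈ L¹_loc(ℂ ∖ 0)`, holomorphic on the slit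
region, has the pairing `ψ ↦ ∫ ψ f` as a whole-plane scaling limit at `α` (by uniqueness of limits this says
THE limit functional is `∫ · f` on test functions; stated through `IsScalingLimit` itself so that it cannot
be met or missed vacuously). -/
def HolomorphicDensity : Prop :=
  ∀ α : ℝ, 0 < α → (∃ Φ : (ℂ → ℂ) → ℂ, IsScalingLimit α Φ) →
    ∃ f : ℂ → ℂ, DifferentiableOn ℂ f slitRegion ∧ LocallyIntegrableOn f {(0 : ℂ)}ᶜ volume ∧
      IsScalingLimit α (fun ψ => ∫ w, ψ w * f w)

/-- **S3, named — rigidity: a dilation-covariant holomorphic density off the cut is a pure power.** -/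
def ProfileRigidity : Prop :=
  ∀ (α : ℝ) (f : ℂ → ℂ), DifferentiableOn ℂ f slitRegion → LocallyIntegrableOn f {(0 : ℂ)}ᶜ volume →
    DilationCovariant α (fun ψ => ∫ w, ψ w * f w) →
      ∃ C : ℂ, ∀ ψ : ℂ → ℂ, TestFn ψ → ∫ w, ψ w * f w = C * profileIntegral α ψ

/-- The crux with its three `let`s delta/zeta-reduced into the §1 vocabulary (definitionally the route
decl, see `twistedPropagatorLaw_iff`). -/
def TwistedPropagatorLaw' : Prop :=
  ∃ (α : ℝ) (C : ℂ), 0 < α ∧ C ≠ 0 ∧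
    ∀ (Λ : ℝ → Finset HexVertex) (x : ℝ → Site 2) (ψ : ℂ → ℂ),
      (∀ s, SAW.hexDomainSimplyConnected (Λ s)) →
      (∀ K : Set ℂ, IsCompact K → ∀ᶠ s : ℝ in Filter.atTop, ∀ v : HexVertex,
          (hexCenter v - triEmbed (x s)) / (s : ℂ) ∈ K → v ∈ Λ s) →
      Continuous ψ → HasCompactSupport ψ → tsupport ψ ⊆ {(0 : ℂ)}ᶜ →
        Filter.Tendsto (smeared Λ x α ψ) Filter.atTop (nhds (C * profileIntegral α ψ))
-- END VOCABULARY

/-- The primed form IS the route decl: `TwistedPropagatorLaw` unfolds (delta, then zeta on `sgn`, `a`, `F`,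
then delta on the §1 vocabulary) to `TwistedPropagatorLaw'`. -/
theorem twistedPropagatorLaw_iff :
    TwistedPropagatorLaw' ↔
      Summit.CriticalPhenomena.SAWScalingLimit.Theses.SAWQuarterTwist.TwistedPropagatorLaw :=
  Iff.rfl

/-! ### 3. The registered stubs (the ONLY `sorry`s of this file) -/

/-- **S1 (HARDEST) — existence of a nondegenerate whole-plane scaling limit with a power normalisation**:
there are an exponent `α > 0` and a functional `Φ`, not identically zero on `C_c(ℂ ∖ 0)`, such that along
EVERY admissible exhaustion `(Λ, x)` and for every test function `ψ`,
`s^{α-2} Σ_e ψ((m_e − triEmbed x_s)/s) F^tw_s(e) → Φ ψ`. Why plausibly true: the twisted two-point function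
is the lattice `⟨ψ†(a)ψ(z)⟩` of the `c = 0` theory, a primary pair of total weight `2h_{1,2} = 5/4`
(IkhlefWestonWheelerZinnJustin2013 §8.2, SimmonsCardy2008), so `α = 5/4` with no logarithm is predicted;
why it might fail: logarithmic corrections / two flux sectors (the crux's recorded risk). -/
theorem stub_scalingLimit :
    ∃ α : ℝ, 0 < α ∧ ∃ Φ : (ℂ → ℂ) → ℂ,
      (∃ ψ₀ : ℂ → ℂ, TestFn ψ₀ ∧ Φ ψ₀ ≠ 0) ∧ IsScalingLimit α Φ := by
  sorry

/-- **S2 — holomorphic density off the cut**: for `α > 0`, if a universal whole-plane scaling limit at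
exponent `α` exists, then for some `f` holomorphic on `ℂ ∖ [0, ∞)` and locally integrable on `ℂ ∖ 0` the
pairing `ψ ↦ ∫ ψ f` is (also, hence by uniqueness of limits: THE) whole-plane scaling limit at `α`.
The regularity half: the limit is a Radon measure (mass bounds are automatic by Banach–Steinhaus); the exact
quarter-twist vertex relation off the cut gives `Φ(∂̄χ) = −Φ₂(∂χ)` with `Φ₂` the orientation-weighted
companion limit, so `∂̄Φ = 0` off the cut (then Weyl) needs the balance of the three mid-edge orientation
classes, plus no singular mass on the gauge cut. -/
theorem stub_holomorphicDensity :
    ∀ α : ℝ, 0 < α → (∃ Φ : (ℂ → ℂ) → ℂ, IsScalingLimit α Φ) →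
      ∃ f : ℂ → ℂ, DifferentiableOn ℂ f slitRegion ∧ LocallyIntegrableOn f {(0 : ℂ)}ᶜ volume ∧
        IsScalingLimit α (fun ψ => ∫ w, ψ w * f w) := by
  sorry

/-- **S3 — profile rigidity** (classical, landable now): a density holomorphic off the cut, locally
integrable on `ℂ ∖ 0`, with dilation-covariant pairing of degree `α − 2`, pairs with test functions as
`C ∫ ψ(w)|w|^{-α}e^{-iαθ(w)} dw` for one constant `C` (Euler homogeneity + identity theorem on the slit
region; the cut is Lebesgue-null). -/
theorem stub_profileRigidity :
    ∀ (α : ℝ) (f : ℂ → ℂ), DifferentiableOn ℂ f slitRegion → LocallyIntegrableOn f {(0 : ℂ)}ᶜ volume →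
      DilationCovariant α (fun ψ => ∫ w, ψ w * f w) →
        ∃ C : ℂ, ∀ ψ : ℂ → ℂ, TestFn ψ → ∫ w, ψ w * f w = C * profileIntegral α ψ := by
  sorry

/-! ### Consistency: each named statement IS its registered stub (definitionally) -/

theorem scalingLimitExists_holds : ScalingLimitExists := stub_scalingLimit
theorem holomorphicDensity_holds : HolomorphicDensity := stub_holomorphicDensity
theorem profileRigidity_holds : ProfileRigidity := stub_profileRigidity

/-! ### Name-keyed aliases of the three statements — the hypotheses of `TwistedPropagatorLaw_of`

The skeleton audit (`#h21_check_skeleton`) admits a hypothesis of the skeleton theorem only if its head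
constant is a registered obligation or is NAMED like a declared stub; `__Registered.stub_X` is the statement
of `stub_X` under that name (device of `Cruxes/AsymptoticMorera/Lines/birth.lean`). Each alias is
`rfl`-equal to its statement. -/
namespace __Registered

/-- Alias of `ScalingLimitExists` keyed by the registered stub name. -/
abbrev stub_scalingLimit : Prop := ScalingLimitExists
/-- Alias of `HolomorphicDensity` keyed by the registered stub name. -/
abbrev stub_holomorphicDensity : Prop := HolomorphicDensity
/-- Alias of `ProfileRigidity` keyed by the registered stub name. -/
abbrev stub_profileRigidity : Prop := ProfileRigidity

end __Registered

/-! ### 4. The sorry-free part: dilation bookkeeping and the composition -/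

/-- Dilating a test function by `c > 0` gives a test function. -/
theorem TestFn.dilate {ψ : ℂ → ℂ} (hψ : TestFn ψ) {c : ℝ} (hc : 0 < c) :
    TestFn (fun w => ψ ((c : ℂ) * w)) := by
  have hc0 : (c : ℂ) ≠ 0 := Complex.ofReal_ne_zero.mpr hc.ne'
  refine ⟨hψ.1.comp (continuous_const_mul (c : ℂ)), ?_, ?_⟩
  · have h := hψ.2.1.comp_homeomorph (Homeomorph.mulLeft₀ (c : ℂ) hc0)
    rwa [Homeomorph.coe_mulLeft₀] at h
  · intro w hw
    rw [Set.mem_compl_singleton_iff]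
    rintro rfl
    have h0 : ψ =ᶠ[𝓝 (0 : ℂ)] 0 :=
      notMem_tsupport_iff_eventuallyEq.mp (fun h => hψ.2.2 h rfl)
    have ht : Filter.Tendsto (fun w : ℂ => (c : ℂ) * w) (𝓝 0) (𝓝 0) := by
      simpa only [mul_zero] using ((continuous_const_mul (c : ℂ)).tendsto (0 : ℂ))
    have h1 : (fun w => ψ ((c : ℂ) * w)) =ᶠ[𝓝 (0 : ℂ)] 0 :=
      (ht.eventually h0).mono fun w hw => by simpa using hw
    exact (notMem_tsupport_iff_eventuallyEq.mpr h1) hw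

/-- Re-indexing an admissible exhaustion along `s ↦ c s` (`c > 0`) gives an admissible exhaustion. -/
theorem IsPlaneExhaustion.rescale {Λ : ℝ → Finset HexVertex} {x : ℝ → Site 2}
    (h : IsPlaneExhaustion Λ x) {c : ℝ} (hc : 0 < c) :
    IsPlaneExhaustion (fun s => Λ (c * s)) (fun s => x (c * s)) := by
  refine ⟨fun s => h.1 (c * s), fun K hK => ?_⟩
  have hcs : Filter.Tendsto (fun s : ℝ => c * s) Filter.atTop Filter.atTop :=
    Filter.tendsto_id.const_mul_atTop hc
  have hK' : IsCompact ((fun z : ℂ => z / (c : ℂ)) '' K) := hK.image (continuous_id.div_const _)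
  filter_upwards [hcs.eventually (h.2 _ hK')] with s hs v hv
  refine hs v ⟨(hexCenter v - triEmbed (x (c * s))) / (s : ℂ), hv, ?_⟩
  simp only [Complex.ofReal_mul]
  ring

/-- The exact rescaling identity behind dilation covariance: for `c, s > 0`,
`T[Λ,x,α](ψ(c·), c s) = c^{α-2} · T[Λ(c·), x(c·), α](ψ, s)` (same mid-edges, same twisted weights; only the
normalising power splits). -/
theorem smeared_rescale (Λ : ℝ → Finset HexVertex) (x : ℝ → Site 2) (α : ℝ) (ψ : ℂ → ℂ) {c s : ℝ}
    (hc : 0 < c) (hs : 0 < s) :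
    smeared Λ x α (fun w => ψ ((c : ℂ) * w)) (c * s) =
      (c : ℂ) ^ ((α : ℂ) - 2) * smeared (fun s => Λ (c * s)) (fun s => x (c * s)) α ψ s := by
  have hc0 : (c : ℂ) ≠ 0 := Complex.ofReal_ne_zero.mpr hc.ne'
  have hs0 : (s : ℂ) ≠ 0 := Complex.ofReal_ne_zero.mpr hs.ne'
  simp only [smeared, Complex.ofReal_mul]
  rw [Complex.mul_cpow_ofReal_nonneg hc.le hs.le, mul_assoc]
  congr 2
  refine finsum_congr fun e => finsum_congr fun _ => ?_
  congr 2
  field_simp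

/-- **Universality ⇒ dilation covariance.** If `Φ` is the scaling limit along EVERY admissible exhaustion
and one admissible exhaustion exists, then `Φ(ψ(c·)) = c^{α-2} Φ(ψ)` for `c > 0`: compare the limits along
`(Λ, x)` at the dilated test function and scales `c s` with the limits along the re-indexed exhaustion. -/
theorem dilationCovariant_of_isScalingLimit {α : ℝ} {Φ : (ℂ → ℂ) → ℂ}
    {Λ : ℝ → Finset HexVertex} {x : ℝ → Site 2}
    (hadm : IsPlaneExhaustion Λ x) (hlim : IsScalingLimit α Φ) : DilationCovariant α Φ := by
  intro c hc ψ hψ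
  have h1 : Filter.Tendsto (smeared (fun s => Λ (c * s)) (fun s => x (c * s)) α ψ) Filter.atTop
      (nhds (Φ ψ)) :=
    hlim _ _ ψ (hadm.rescale hc) hψ
  have h2 : Filter.Tendsto (fun s => smeared Λ x α (fun w => ψ ((c : ℂ) * w)) (c * s)) Filter.atTop
      (nhds (Φ (fun w => ψ ((c : ℂ) * w)))) :=
    (hlim Λ x _ hadm (hψ.dilate hc)).comp (Filter.tendsto_id.const_mul_atTop hc)
  have h3 : (fun s => smeared Λ x α (fun w => ψ ((c : ℂ) * w)) (c * s)) =ᶠ[Filter.atTop]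
      fun s => (c : ℂ) ^ ((α : ℂ) - 2) * smeared (fun s => Λ (c * s)) (fun s => x (c * s)) α ψ s :=
    (Filter.eventually_gt_atTop 0).mono fun s hs => smeared_rescale Λ x α ψ hc hs
  exact tendsto_nhds_unique (h2.congr' h3) (h1.const_mul _)

/-- **The composition in the delta/zeta-reduced form** (no `sorry`): S1 gives `α > 0` and a
nondegenerate universal limit `Φ`; S2 gives a holomorphic, locally integrable density `f` whose pairing
`∫ · f` is a universal limit at `α` too. If an admissible exhaustion exists, uniqueness of limits along it
identifies `Φ ψ₀ = ∫ ψ₀ f`, universality makes `∫ · f` dilation covariant, S3 turns covariance + holomorphy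
into `∫ ψ f = C ∫ ψ w^{-α}`, and `C ≠ 0` by nondegeneracy; otherwise the crux is vacuous. -/
theorem twistedPropagatorLaw'_of (h1 : ScalingLimitExists) (h2 : HolomorphicDensity)
    (h3 : ProfileRigidity) : TwistedPropagatorLaw' := by
  obtain ⟨α, hα, Φ, ⟨ψ₀, hψ₀, hne⟩, hlim⟩ := h1
  by_cases hex : ∃ (Λ : ℝ → Finset HexVertex) (x : ℝ → Site 2), IsPlaneExhaustion Λ x
  · obtain ⟨Λ₀, x₀, hadm₀⟩ := hex
    obtain ⟨f, hf, hfi, hlimf⟩ := h2 α hα ⟨Φ, hlim⟩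
    have hcov : DilationCovariant α (fun ψ => ∫ w, ψ w * f w) :=
      dilationCovariant_of_isScalingLimit hadm₀ hlimf
    obtain ⟨C, hC⟩ := h3 α f hf hfi hcov
    -- the two universal limits agree along the admissible exhaustion `(Λ₀, x₀)`
    have hrep : Φ ψ₀ = ∫ w, ψ₀ w * f w :=
      tendsto_nhds_unique (hlim Λ₀ x₀ ψ₀ hadm₀ hψ₀) (hlimf Λ₀ x₀ ψ₀ hadm₀ hψ₀)
    have hCne : C ≠ 0 := by
      rintro rfl
      apply hne
      rw [hrep, hC ψ₀ hψ₀, zero_mul]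
    refine ⟨α, C, hα, hCne, ?_⟩
    intro Λ x ψ hsc hK hψc hψs hψ0
    have h := hlimf Λ x ψ ⟨hsc, hK⟩ ⟨hψc, hψs, hψ0⟩
    dsimp only at h
    rwa [hC ψ ⟨hψc, hψs, hψ0⟩] at h
  · refine ⟨α, 1, hα, one_ne_zero, ?_⟩
    intro Λ x ψ hsc hK _ _ _
    exact absurd ⟨Λ, x, ⟨hsc, hK⟩⟩ hex

/-! ### 5. The skeleton theorem: the three stubs imply the crux, BY NAME -/

/-- **`TwistedPropagatorLaw` from the line `birth`** (kernel-checked, no `sorry` of its own): hypotheses =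
the three stubs under their registered names; conclusion = the route decl, by name. -/
theorem TwistedPropagatorLaw_of (h1 : __Registered.stub_scalingLimit)
    (h2 : __Registered.stub_holomorphicDensity) (h3 : __Registered.stub_profileRigidity) :
    Summit.CriticalPhenomena.SAWScalingLimit.Theses.SAWQuarterTwist.TwistedPropagatorLaw :=
  twistedPropagatorLaw_iff.mp (twistedPropagatorLaw'_of h1 h2 h3)

/-- Wiring check (an `example`, so that `TwistedPropagatorLaw_of` stays the only theorem concluding the
crux): the registered stubs, with their stated types, feed the skeleton theorem — this term becomes the
crux proof when the three `sorry`s above are discharged. -/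
example : Summit.CriticalPhenomena.SAWScalingLimit.Theses.SAWQuarterTwist.TwistedPropagatorLaw :=
  TwistedPropagatorLaw_of stub_scalingLimit stub_holomorphicDensity stub_profileRigidity

end Summit.CriticalPhenomena.SAWScalingLimit.Cruxes.TwistedPropagatorLaw.Birth

end
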